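import Literature.AlgebraicGeometry.HodgeTheory.AbsoluteHodgeClasses
import Literature.AlgebraicGeometry.HodgeTheory.GAGADimensionCharts
import Literature.NumberTheory.Transcendental.OneFormWedgeDeterminant
import Literature.NumberTheory.Transcendental.AnalytificationProofs
import Literature.RingTheory.Derivation.SubmersivePresentationTwistedDerivation
import Literature.Geometry.Kaehler.ConnectionExists
import Literature.Geometry.Kaehler.PluriharmonicLog
import Literature.Geometry.Kaehler.LocalForms
import HarnessLib

/-!
# Point derivations on an analytic model and the readout of a realised form expression

Two inputs of the proof that conjugation preserves closedness of realised algebraic forms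
(`ConjRealizeClosedProofs`, discharging `conj_realize_mem_cclosedSmoothForms`):

* `AnalyticModel.isTwistedDerivation_mextDeriv_ofFun` — on an analytic model `B` of a `ℂ`-scheme
  `X`, the differentials at a point `x` of regular functions read on `X^an`,
  `s ↦ d((ψ s) ∘ φ)ₓ` (`ψ : S →+* Γ(X, U)` a ring homomorphism), form a TWISTED point derivation
  (`Literature.RingTheory.Derivation.IsTwistedDerivation`) along any `χ : S →+* ℂ` computing the
  values at `x` (regular functions are holomorphic, hence `C^∞`; Leibniz rule for `d`); with
  `ψ = id` this is the honest point derivation along `ev`, with `ψ = π^*` on a conjugate variety it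
  is twisted by `σ`. `AnalyticModel.mextDeriv_ofFun_evalOrZero_res`: locality in the open.
* `readoutCoeff`, `readout_eq` — for a submersive presentation of `S` and ANY twisted derivation
  `D` into the `ℂ`-valued `1`-forms at a point, a realised expression
  `∑ⱼ χ(cⱼ) D(g_{j,0}) ∧ ⋯ ∧ D(g_{j,n-1})` equals `∑ₛ χ(aₛ) θ_{J_s}` with coefficients `aₛ ∈ S`
  depending only on the expression and the presentation (chain rule + elimination,
  `IsTwistedDerivation.sum_smul_multilinear_eq`; regrouping of the alternating iterated wedge,
  `AlternatingMap.sum_smul_comp_eq_sum_powersetCard`), `θ_J` the iterated wedges of the free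
  coordinate differentials along increasing `J`.

## References

* J.-P. Serre, *Géométrie algébrique et géométrie analytique* (1956), §1 n°4, §2.
* F. Charles, C. Schnell, *Notes on absolute Hodge classes* (2014), §11.2.2.
-/

noncomputable section

open scoped Manifold ContDiff Topology
open CategoryTheory AlgebraicGeometry Filter
open Literature.NumberTheory.Transcendental Literature.Geometry.Kaehler
open Literature.RingTheory.Derivation

namespace Literature.AlgebraicGeometry.HodgeTheory

section HodgeTheory

variable {E : Type} [NormedAddCommGroup E] [NormedSpace ℂ E] [FiniteDimensional ℂ E]

/-! ### Point derivations of regular functions read on an analytic model -/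

namespace AnalyticModel

variable {m : ℕ} {X : Motives.SchemeOver ℂ} (B : AnalyticModel E m X)

/-- **Differentials of regular functions at a point form a (twisted) point derivation.** Let
`B` be an analytic model of `X`, `U ⊆ X` open, `x ∈ X^an` over `U`, `ψ : S →+* Γ(X, U)` a ring
homomorphism from an `R₀`-algebra `S` and `χ : S →+* ℂ` with `(ψ s)(φ x) = χ(s)`; assume the
`ψ`-images of constants are locally constant near `x` when read on `X^an`. Then
`s ↦ d((ψ s) ∘ φ)ₓ` is a `χ`-twisted derivation killing `R₀`: regular functions are holomorphic
on `X^an`, hence `C^∞`, and `d` obeys the Leibniz rule. (With `ψ = id`, `χ = ev`: an honest point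
derivation; with `ψ = π^*` on a conjugate variety, `χ = σ ∘ ev`.) [cite: SerreGAGA1956, §2] -/
theorem isTwistedDerivation_mextDeriv_ofFun (U : X.left.Opens) {x : B.carrier}
    (hx : (B.toComplexPoints x).pt ∈ U) {S R₀ : Type*} [CommRing S] [CommRing R₀] [Algebra R₀ S]
    (ψ : S →+* Γ(X.left, U)) (χ : S →+* ℂ)
    (hχ : ∀ s, Motives.AlgPoints.evalOrZero U (ψ s) (B.toComplexPoints x) = χ s)
    (hconst : ∀ r : R₀, ∀ᶠ z in 𝓝 x,
      Motives.AlgPoints.evalOrZero U (ψ (algebraMap R₀ S r)) (B.toComplexPoints z) =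
        Motives.AlgPoints.evalOrZero U (ψ (algebraMap R₀ S r)) (B.toComplexPoints x)) :
    IsTwistedDerivation R₀ χ (fun s ↦ (mextDeriv (MForm.ofFun 𝓘(ℝ, E) fun z ↦
      Motives.AlgPoints.evalOrZero U (ψ s) (B.toComplexPoints z)) x : E [⋀^Fin 1]→L[ℝ] ℂ)) := by
  haveI : CompleteSpace ℂ := inferInstance
  have hO : IsOpen (B.toComplexPoints ⁻¹' {P | P.pt ∈ U}) := B.isAnalytification.isOpen_preimage U
  have hsm : ∀ s, ContMDiffAt 𝓘(ℝ, E) 𝓘(ℝ, ℂ) ∞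
      (fun z ↦ Motives.AlgPoints.evalOrZero U (ψ s) (B.toComplexPoints z)) x := fun s ↦
    contMDiffAt_real_of_mdifferentiableOn_complex
      (IsAnalytification.mdifferentiableOn_evalOrZero_opens_holds B.isAnalytification U (ψ s)) hO hx
  refine ⟨fun s t ↦ ?_, fun s t ↦ ?_, fun r ↦ ?_⟩
  · have h : (fun z ↦ Motives.AlgPoints.evalOrZero U (ψ (s + t)) (B.toComplexPoints z)) =
        (fun z ↦ Motives.AlgPoints.evalOrZero U (ψ s) (B.toComplexPoints z)) +
          fun z ↦ Motives.AlgPoints.evalOrZero U (ψ t) (B.toComplexPoints z) := by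
      funext z
      rw [map_add, GAGADimension.evalOrZero_add]
      rfl
    rw [h, MForm.ofFun_add, mextDeriv_add_apply (MForm.smoothAt_ofFun_of_contMDiffAt (hsm s))
      (MForm.smoothAt_ofFun_of_contMDiffAt (hsm t))]
  · have h : (fun z ↦ Motives.AlgPoints.evalOrZero U (ψ (s * t)) (B.toComplexPoints z)) =
        fun z ↦ Motives.AlgPoints.evalOrZero U (ψ s) (B.toComplexPoints z) *
          Motives.AlgPoints.evalOrZero U (ψ t) (B.toComplexPoints z) := by
      funext z
      rw [map_mul, GAGADimension.evalOrZero_mul]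
      rfl
    rw [h]
    ext v
    rw [mextDeriv_ofFun_mul_apply (hsm s) (hsm t) v, hχ, hχ, ContinuousAlternatingMap.add_apply,
      ContinuousAlternatingMap.smul_apply, ContinuousAlternatingMap.smul_apply, add_comm]
  · have hc : mextDeriv (MForm.ofFun 𝓘(ℝ, E) fun z ↦
        Motives.AlgPoints.evalOrZero U (ψ (algebraMap R₀ S r)) (B.toComplexPoints z)) x =
        mextDeriv (MForm.ofFun 𝓘(ℝ, E) fun _ : B.carrier ↦
          Motives.AlgPoints.evalOrZero U (ψ (algebraMap R₀ S r)) (B.toComplexPoints x)) x := by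
      refine mextDeriv_congr_of_eventuallyEq ?_
      filter_upwards [hconst r] with z hz
      ext v
      simp only [MForm.ofFun_apply, hz]
    rw [hc]
    exact congrFun (mextDeriv_ofFun_const (I := 𝓘(ℝ, E)) (M := B.carrier)
      (Motives.AlgPoints.evalOrZero U (ψ (algebraMap R₀ S r)) (B.toComplexPoints x))) x

/-- The differential at `x` of a regular function read on `X^an` only depends on its restriction
to an open `U ∋ φ(x)`: `d(s ∘ φ)ₓ = d(s|_U ∘ φ)ₓ`. [folklore] -/
theorem mextDeriv_ofFun_evalOrZero_res {U U' : X.left.Opens} (i : U ≤ U') {x : B.carrier}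
    (hx : (B.toComplexPoints x).pt ∈ U) (s : Γ(X.left, U')) :
    mextDeriv (MForm.ofFun 𝓘(ℝ, E) fun z ↦
        Motives.AlgPoints.evalOrZero U' s (B.toComplexPoints z)) x =
      mextDeriv (MForm.ofFun 𝓘(ℝ, E) fun z ↦ Motives.AlgPoints.evalOrZero U
        (X.left.presheaf.map (homOfLE i).op s) (B.toComplexPoints z)) x := by
  refine mextDeriv_congr_of_eventuallyEq ?_
  have hO : IsOpen (B.toComplexPoints ⁻¹' {P | P.pt ∈ U}) := B.isAnalytification.isOpen_preimage U
  filter_upwards [hO.mem_nhds hx] with z hz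
  ext v
  simp only [MForm.ofFun_apply]
  rw [Motives.AlgPoints.evalOrZero_of_mem _ (i hz), Motives.AlgPoints.evalOrZero_of_mem _ hz,
    Motives.AlgPoints.eval_res]

end AnalyticModel

/-! ### The common readout of a realisation and of its conjugate at corresponding points -/

section Readout

variable {R₀ S : Type*} [CommRing R₀] [CommRing S] [Algebra R₀ S]
  {ι τ : Type*} [Fintype ι] [Fintype τ] [DecidableEq ι] [DecidableEq τ]
  (Pres : Algebra.SubmersivePresentation R₀ S ι τ) {N : ℕ} (ε : Fin N ≃ Free Pres)

/-- The **readout coefficients** `aₛ ∈ S` of a form expression `(cⱼ, g_{j,l})` over a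
submersively presented algebra, indexed by the `n`-element subsets `s` of the (reindexed) free
variables: `aₛ = ∑_I det[I(i) = J_s(j)] · ∑ⱼ cⱼ ∏ₗ implicitCoeff g_{j,l} (I l)` — the alternation,
over increasing index maps, of the expansion in the free differentials
(`IsTwistedDerivation.sum_smul_multilinear_eq`). They depend on the expression and the
presentation only. [folklore] -/
def readoutCoeff {n M' : ℕ} (coef : Fin M' → S) (arg : Fin M' → Fin n → S)
    (s : Set.powersetCard (Fin N) n) : S :=
  ∑ I : Fin n → Fin N,
    (Matrix.of fun i j ↦
        if I i = (Set.powersetCard.ofFinEmbEquiv.symm s) j then (1 : ℤ) else 0).det •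
      ∑ j, coef j * ∏ l, implicitCoeff Pres (arg j l) (ε (I l))

variable {V₀ : Type*} [NormedAddCommGroup V₀] [NormedSpace ℝ V₀]

/-- **The readout identity.** For every `χ`-twisted derivation `D` into the `ℂ`-valued `1`-forms
on a real normed space, `∑ⱼ χ(cⱼ) · D(g_{j,0}) ∧ ⋯ ∧ D(g_{j,n-1}) = ∑ₛ χ(aₛ) · θ_{J_s}`, where
`θ_J = D(x_{J(0)}) ∧ ⋯ ∧ D(x_{J(n-1)})` are the iterated wedges of the free coordinate differentials
along increasing `J` and `aₛ` are the readout coefficients (independent of `χ`, `D`): expansion in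
the free differentials, then regrouping of the alternating iterated wedge. [folklore] -/
theorem readout_eq {χ : S →+* ℂ} {D : S → (V₀ [⋀^Fin 1]→L[ℝ] ℂ)} (hD : IsTwistedDerivation R₀ χ D)
    {n M' : ℕ} (coef : Fin M' → S) (arg : Fin M' → Fin n → S) :
    ∑ j, χ (coef j) • ContinuousAlternatingMap.iterWedge n (fun l ↦ D (arg j l)) =
      ∑ s : Set.powersetCard (Fin N) n, χ (readoutCoeff Pres ε coef arg s) •
        ContinuousAlternatingMap.iterWedge n
          ((fun a ↦ D (Pres.val (ε a).1)) ∘ (Set.powersetCard.ofFinEmbEquiv.symm s)) := by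
  classical
  set f := ContinuousAlternatingMap.iterWedgeAlt ℝ V₀ ℂ n with hf
  -- expansion in the free differentials
  have h1 := hD.sum_smul_multilinear_eq Pres f.toMultilinearMap coef arg
  simp only [AlternatingMap.coe_multilinearMap, hf, ContinuousAlternatingMap.iterWedgeAlt_apply] at h1
  rw [h1]
  -- reindex the free variables by `Fin N`
  set b : (Fin n → Free Pres) → S := fun I ↦ ∑ j, coef j * ∏ l, implicitCoeff Pres (arg j l) (I l)
    with hb
  set u : Fin N → (V₀ [⋀^Fin 1]→L[ℝ] ℂ) := fun a ↦ D (Pres.val (ε a).1) with hu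
  have h2 : ∑ I : Fin n → Free Pres, χ (b I) •
      ContinuousAlternatingMap.iterWedge n (fun l ↦ D (Pres.val (I l).1)) =
        ∑ I' : Fin n → Fin N, χ (b (ε ∘ I')) • f (u ∘ I') := by
    refine (Fintype.sum_equiv ((Equiv.refl (Fin n)).arrowCongr ε) _ _ fun I' ↦ ?_).symm
    simp only [hf, ContinuousAlternatingMap.iterWedgeAlt_apply, Equiv.arrowCongr_apply]
    rfl
  rw [h2, AlternatingMap.sum_smul_comp_eq_sum_powersetCard f u fun I' ↦ χ (b (ε ∘ I'))]
  refine Finset.sum_congr rfl fun s _ ↦ ?_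
  simp only [hf, ContinuousAlternatingMap.iterWedgeAlt_apply]
  congr 1
  -- the coefficient of `θ_{J_s}` is `χ (readoutCoeff … s)`
  rw [readoutCoeff, map_sum]
  refine Finset.sum_congr rfl fun I' _ ↦ ?_
  have hdet : (((Matrix.of fun i j ↦
      if I' i = (Set.powersetCard.ofFinEmbEquiv.symm s) j then (1 : ℤ) else 0).det : ℤ) : ℂ) =
      (Matrix.of fun i j ↦
        if I' i = (Set.powersetCard.ofFinEmbEquiv.symm s) j then (1 : ℂ) else 0).det := by
    rw [show ∀ z : ℤ, (z : ℂ) = Int.castRingHom ℂ z from fun z ↦ rfl, RingHom.map_det]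
    congr 1
    ext i j
    simp only [RingHom.mapMatrix_apply, Matrix.map_apply, Matrix.of_apply]
    split_ifs <;> simp
  rw [map_zsmul, zsmul_eq_mul, hdet, mul_comm]
  rfl

end Readout

end HodgeTheory

end Literature.AlgebraicGeometry.HodgeTheory

end
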